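import Summits.QuantumFields.QCD.Theses.SpectralDefectExtinction
import Summits.QuantumFields.QCD.Theorems.ExtinctionBuildsQCD.Negative.WithoutTightCollapse
import Summits.QuantumFields.QCD.Theorems.SpectralDefectExtinctionTipPricingStubTightOfMoments

/-!
# The TIGHT format theorem of line `tight-from-two-moments`
(crux `Summit.QuantumFields.QCD.Theses.SpectralDefectExtinction.TipPricing`, item stmt-QuantumFields-8967;
helper file, `--supports`)

**What is proved (sorry-free, no named facts).** `tight_of_indexMoments`: for ANY witness data
`(reg : QCDRegularisation N_f, M₀, m)` — physical line, free-volume line, or a future repaired witness alike —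
the WEAK EVEN-MOMENT CONDITIONS on the spectral index `Q_k(M) = n₋(Γ₅ D_W(U, m_crit(k) − a_k M/Z_k, 1)) − 6(2L_k+1)⁴`
under the phase-quenched weight `w_k = ∏_f |det D_W(U, m_f(k), 1)|` on the scheme torus,
"for every probe `M > M₀` there is `K` with, eventually in `k`, `Z_k > 0`, `max(K,1)·Z_k ≤ S₂(k)` and
`S₄(k)·Z_k ≤ K·S₂(k)²`" (`Z = ∫ w`, `S₂ = ∫ Q² w`, `S₄ = ∫ Q⁴ w`), imply the route's TIGHT clause
`Tight N_f reg M₀ m` (`Theorems/ExtinctionBuildsQCD/Negative/WithoutTightCollapse.lean`) — by the landed Hölder step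
`stub_tightOfMoments` (p98847) at side `2L_k+1`, probe `m_crit(k) − a_k M/Z_k`, offset `6(2L_k+1)⁴`, after the real
arithmetic `moments_arith`.  Also recorded for the line's composition: `floor_arith` (an INTENSIVE floor
`χ₀ · V · Z ≤ S₂` with `max(K,1)/χ₀ ≤ V` gives the weak floor) and `physVolume_eventually_ge` (the physical four-volume
`(a_k(2L_k+1))⁴` of any `QCDRegularisation` is eventually above every bound, from the structure field `tendsto_L`).
This is the witness-agnostic "Tightness stub format" the triage panel (r1-1/r1-2) asked for; the skeleton
`Cruxes/TipPricing/Lines/tight-from-two-moments.lean` imports it.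
-/

noncomputable section

namespace Summit.QuantumFields.QCD.Cruxes.TipPricing.TightFromTwoMoments

open scoped BigOperators Topology Classical
open MeasureTheory Filter
open Literature.MathematicalPhysics.QuantumLattice Literature.MathematicalPhysics.QuantumFieldTheory
  Literature.Probability.LatticeModels
open Summit.QuantumFields.QCD.Theses.SpectralDefectExtinction
open Summit.QuantumFields.QCD.Theorems.ExtinctionBuildsQCD.Negative

/-! ## Real arithmetic of the moment conditions -/

/-- Real arithmetic of the weak moment form: `Z > 0`, `max(K,1)·Z ≤ S₂`, `S₄ Z ≤ K S₂²` give `S₂ > 0` and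
`S₄ Z² ≤ S₂³` (the hypotheses of `stub_tightOfMoments`). [folklore] -/
theorem moments_arith {Z S2 S4 K : ℝ} (hZ : 0 < Z) (hfloor : max K 1 * Z ≤ S2) (hcap : S4 * Z ≤ K * S2 ^ 2) :
    0 < S2 ∧ S4 * Z ^ 2 ≤ S2 ^ 3 := by
  have h1 : Z ≤ max K 1 * Z := le_mul_of_one_le_left hZ.le (le_max_right K 1)
  have hS2 : 0 < S2 := lt_of_lt_of_le hZ (h1.trans hfloor)
  refine ⟨hS2, ?_⟩
  calc S4 * Z ^ 2 = S4 * Z * Z := by ring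
    _ ≤ K * S2 ^ 2 * Z := mul_le_mul_of_nonneg_right hcap hZ.le
    _ ≤ max K 1 * S2 ^ 2 * Z :=
        mul_le_mul_of_nonneg_right (mul_le_mul_of_nonneg_right (le_max_left K 1) (sq_nonneg S2)) hZ.le
    _ = S2 ^ 2 * (max K 1 * Z) := by ring
    _ ≤ S2 ^ 2 * S2 := mul_le_mul_of_nonneg_left hfloor (sq_nonneg S2)
    _ = S2 ^ 3 := by ring

/-- Real arithmetic of the intensive floor: `χ₀ > 0`, `Z > 0`, `max(K,1)/χ₀ ≤ V` and `χ₀ V Z ≤ S₂` give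
`max(K,1)·Z ≤ S₂`. [folklore] -/
theorem floor_arith {K χ₀ V Z S2 : ℝ} (hχ₀ : 0 < χ₀) (hZ : 0 < Z) (hV : max K 1 / χ₀ ≤ V)
    (hfl : χ₀ * V * Z ≤ S2) : max K 1 * Z ≤ S2 := by
  have h1 : max K 1 ≤ χ₀ * V := by
    rw [div_le_iff₀ hχ₀] at hV
    linarith [mul_comm V χ₀]
  exact (mul_le_mul_of_nonneg_right h1 hZ.le).trans hfl

/-- **The physical four-volume of the scheme torus diverges**: `(a_k (2 L_k + 1))⁴ → ∞`, from the structure field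
`QCDRegularisation.tendsto_L : a_k L_k → ∞` and `a_k > 0`. [folklore] -/
theorem physVolume_eventually_ge {Nf : ℕ} (reg : QCDRegularisation Nf) (R : ℝ) :
    ∀ᶠ k : ℕ in Filter.atTop, R ≤ (reg.a k * (2 * reg.L k + 1 : ℝ)) ^ 4 := by
  have h1 : Tendsto (fun k => reg.a k * (2 * reg.L k + 1 : ℝ)) atTop atTop := by
    refine tendsto_atTop_mono (fun k => ?_) reg.tendsto_L
    have := (reg.a_pos k).le
    nlinarith
  have h2 : Tendsto (fun k => (reg.a k * (2 * reg.L k + 1 : ℝ)) ^ 4) atTop atTop :=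
    (tendsto_pow_atTop (by norm_num : (4 : ℕ) ≠ 0)).comp h1
  exact h2.eventually_ge_atTop R

/-- **The reusable format (any line, any witness): TIGHT from the weak moment conditions.** For every witness data
`(reg, M₀, m)`: if for each probe `M > M₀` there is `K` with, eventually in `k`, `Z_k > 0`,
`max(K,1) · Z_k ≤ S₂ = ∫ Q_k(M)² w_k` and `S₄ · Z_k ≤ K · S₂²`, then `Tight N_f reg M₀ m` — by `stub_tightOfMoments` at
side `2L_k+1`, probe `m_crit(k) − a_k M/Z_k`, offset `6(2L_k+1)⁴`. This is the step every TIGHT-attacking line can call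
(the physical line below; equally the volume line at the junk line, where compound-Poisson increments give kurtosis `→ 3`).
[folklore] -/
theorem tight_of_indexMoments {Nf : ℕ} (reg : QCDRegularisation Nf) (M₀ : ℝ) (m : Fin Nf → ℝ)
    (h : ∀ M : ℝ, M₀ < M → ∃ K : ℝ, ∀ᶠ k : ℕ in Filter.atTop,
      0 < (∫ U, ∏ f : Fin Nf, ‖fermionDet (wilsonDirac (fundamentalRep (Fin 3)) U (reg.mcrit k + reg.a k * m f / reg.Zm k) 1)‖ ∂(wilsonMeasure (d := 4) (L := 2 * reg.L k + 1) (fundamentalRep (Fin 3)) (reg.β k))) ∧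
      max K 1 * (∫ U, ∏ f : Fin Nf, ‖fermionDet (wilsonDirac (fundamentalRep (Fin 3)) U (reg.mcrit k + reg.a k * m f / reg.Zm k) 1)‖ ∂(wilsonMeasure (d := 4) (L := 2 * reg.L k + 1) (fundamentalRep (Fin 3)) (reg.β k)))
        ≤ (∫ U, ((Multiset.countP (fun z : ℂ => z.re < 0) (spinorLift gammaFive * wilsonDirac (fundamentalRep (Fin 3)) U (reg.mcrit k - reg.a k * M / reg.Zm k) 1).charpoly.roots : ℝ) - 6 * (2 * reg.L k + 1 : ℝ) ^ 4) ^ 2 * ∏ f : Fin Nf, ‖fermionDet (wilsonDirac (fundamentalRep (Fin 3)) U (reg.mcrit k + reg.a k * m f / reg.Zm k) 1)‖ ∂(wilsonMeasure (d := 4) (L := 2 * reg.L k + 1) (fundamentalRep (Fin 3)) (reg.β k))) ∧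
      (∫ U, ((Multiset.countP (fun z : ℂ => z.re < 0) (spinorLift gammaFive * wilsonDirac (fundamentalRep (Fin 3)) U (reg.mcrit k - reg.a k * M / reg.Zm k) 1).charpoly.roots : ℝ) - 6 * (2 * reg.L k + 1 : ℝ) ^ 4) ^ 4 * ∏ f : Fin Nf, ‖fermionDet (wilsonDirac (fundamentalRep (Fin 3)) U (reg.mcrit k + reg.a k * m f / reg.Zm k) 1)‖ ∂(wilsonMeasure (d := 4) (L := 2 * reg.L k + 1) (fundamentalRep (Fin 3)) (reg.β k))) * (∫ U, ∏ f : Fin Nf, ‖fermionDet (wilsonDirac (fundamentalRep (Fin 3)) U (reg.mcrit k + reg.a k * m f / reg.Zm k) 1)‖ ∂(wilsonMeasure (d := 4) (L := 2 * reg.L k + 1) (fundamentalRep (Fin 3)) (reg.β k)))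
        ≤ K * (∫ U, ((Multiset.countP (fun z : ℂ => z.re < 0) (spinorLift gammaFive * wilsonDirac (fundamentalRep (Fin 3)) U (reg.mcrit k - reg.a k * M / reg.Zm k) 1).charpoly.roots : ℝ) - 6 * (2 * reg.L k + 1 : ℝ) ^ 4) ^ 2 * ∏ f : Fin Nf, ‖fermionDet (wilsonDirac (fundamentalRep (Fin 3)) U (reg.mcrit k + reg.a k * m f / reg.Zm k) 1)‖ ∂(wilsonMeasure (d := 4) (L := 2 * reg.L k + 1) (fundamentalRep (Fin 3)) (reg.β k))) ^ 2) :
    Tight Nf reg M₀ m := by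
  intro M hM
  obtain ⟨K, hK⟩ := h M hM
  filter_upwards [hK] with k hk
  obtain ⟨hZ, hfloor, hcap⟩ := hk
  obtain ⟨hS2, hmom⟩ := moments_arith hZ hfloor hcap
  exact stub_tightOfMoments Nf (2 * reg.L k + 1) (reg.β k) (reg.mcrit k - reg.a k * M / reg.Zm k)
    (6 * (2 * reg.L k + 1 : ℝ) ^ 4) (fun f => reg.mcrit k + reg.a k * m f / reg.Zm k) hZ hS2 hmom

end Summit.QuantumFields.QCD.Cruxes.TipPricing.TightFromTwoMoments

end
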